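import Summits.CriticalPhenomena.PercolationContinuityZ3.Theorems.Transplant.SkelFrmBChoiceDefsV
import Summits.CriticalPhenomena.PercolationContinuityZ3.Theorems.Transplant.SkelFrmBChoiceDefs3
import HarnessLib

/-!
# N2 (frames-only node `SamePDropOfSkeletonFrm₁`, OPEN) — `AtQNQ` OF THE V CHOICES OF RECORD IS THE LANDED PREMISE:
# `NegB.choiceAtQ3V_atQNQ_iff`, `NegB.atQ3_of_atQ3V`, `NegB.atQ3V_of_atQ3`

The V twin of §0 of SkelFrmBChoiceAtQT (stmt-g21, p361161), for stmt-g21's SEVEN-slot choices of record under (R-44)/(R-45)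
`NegB.choiceAtQ3V κ Φ t p Pv gv fv Sv cv hv bv hC` (SkelFrmBChoiceDefsV): the premise `ChoiceNQ.AtQNQ 𝒞 O q` reads only `𝒞.m₀`, `𝒞.Sz`,
`𝒞.SMn`, `𝒞.δI` (SkelFrm1ChoiceDefs), and these four fields of `choiceAtQ3V` agree with those of the landed S choices `choiceAtQ3`
(SkelFrmBChoiceDefs3) by `rfl` (`choiceAtQ3V_δI/_m₀/_Sz/_SMn`) — so every cell-free `…_of_atQ` consequence typed at `choiceAtQ3` serves the V
function through `atQ3_of_atQ3V` (the (R) skeletons `rootLegAt_frmQ3KV_fst/_snd` use exactly this one conversion).  Filed by p3 (design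
owner) by arrangement with stmt-g21 (lane INBOX 15:21:16Z: "AtQV: YOU file `atQ3_of_atQ3V`; I file nothing named AtQV").
NON-VACUITY (lead g11 standing order): a `rfl`-level rewriting of the premise; nothing assumed.
builds on p205010 (kernel theorem, internal audit signed; external expert review pending) — nothing in this file uses p205010; NOTHING is claimed
about the open node `SamePDropOfSkeletonFrm₁`.
Lane `prim-bschramm`, seat `prim-bschramm-p3` (gen 18; N2 design owner, (R) column owner); helper file (`--supports stmt-CriticalPhenomena-4575 --as helper`).
[cite: KozmaNitzan2024, §4 Theorem 6 (pp. 25–31)]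
-/

noncomputable section

open scoped Classical

namespace Summit.CriticalPhenomena.PercolationContinuityZ3.Theorems.Transplant

open MeasureTheory Literature.Probability.Percolation Literature.Probability.LatticeModels SimpleGraph KNCells KNLevels

namespace PlanarSkeletonFrm

open SkelConc (Consts)
open Skelφ.StepI (DataN DataNS OutNS)

namespace NegB

open Neg

section AtQ

variable {κ : Consts} {V : Type} [DecidableEq V] [Countable V] {G : SimpleGraph V} [G.LocallyFinite] {Φ : PlanarSkeletonFrm G} {t : V} {p : unitInterval}
  {hC : Φ.CylSubcritical p} {gv fv : Neg.FSlot} {Pv : PSlot} {Sv : SSlot} {cv hv : CSlot} {bv : BSlot} {O : OutNS V} {q : unitInterval}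

/-- **`AtQNQ` is the same premise for the V choices of record and the landed S choices** (it reads only `m₀`, `Sz`, `SMn`, `δI`, which agree by
`rfl`). [folklore] -/
theorem choiceAtQ3V_atQNQ_iff : (choiceAtQ3V κ Φ t p Pv gv fv Sv cv hv bv hC).AtQNQ O q ↔ (choiceAtQ3 κ Φ t p Pv gv fv Sv cv bv hC).AtQNQ O q := by
  -- NOT `Iff.rfl` (the unifier would compare the two choice structures field by field); unfold the premise and rewrite the four fields it reads.
  simp only [ChoiceNQ.AtQNQ, choiceAtQ3V_δI, choiceAtQ3V_m₀, choiceAtQ3V_Sz, choiceAtQ3V_SMn, choiceAtQ3_δI]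

/-- `AtQNQ` of the V choices gives `AtQNQ` of the landed S choices (so every cell-free `…_of_atQ` lemma serves the V function). [folklore] -/
theorem atQ3_of_atQ3V (hAt : (choiceAtQ3V κ Φ t p Pv gv fv Sv cv hv bv hC).AtQNQ O q) : (choiceAtQ3 κ Φ t p Pv gv fv Sv cv bv hC).AtQNQ O q :=
  choiceAtQ3V_atQNQ_iff.1 hAt

/-- And conversely. [folklore] -/
theorem atQ3V_of_atQ3 (hAt : (choiceAtQ3 κ Φ t p Pv gv fv Sv cv bv hC).AtQNQ O q) : (choiceAtQ3V κ Φ t p Pv gv fv Sv cv hv bv hC).AtQNQ O q :=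
  choiceAtQ3V_atQNQ_iff.2 hAt

end AtQ

end NegB

end PlanarSkeletonFrm

end Summit.CriticalPhenomena.PercolationContinuityZ3.Theorems.Transplant

end
-- build-touch 2026-08-25T06:13:22Z T1-A (lead g18): re-land of p391464, declarations byte-identical
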